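import Summits.AtomisticToContinuum.BoseEinsteinCondensation.Theorems.BECInsertionCorrectorStaticResponseBoundFewBody5AllCouplingPT
import Summits.AtomisticToContinuum.BoseEinsteinCondensation.Theorems.BECInsertionCorrectorStaticResponseBoundFewBody5Assembly
import Summits.AtomisticToContinuum.BoseEinsteinCondensation.Theorems.BECInsertionCorrectorStaticResponseBoundFewBody5Window
import Summits.AtomisticToContinuum.BoseEinsteinCondensation.Theorems.BECInsertionCorrectorStaticResponseBoundFewBody5Composition
import Summits.AtomisticToContinuum.BoseEinsteinCondensation.Theorems.BECInsertionCorrectorStaticResponseBoundFewBody5WeakCoupling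
import HarnessLib

/-!
# The few-body half of the static response bound with the QUINTIC window — headline theorems of the seat-a1 layer,
# UNCONDITIONAL (line `stable-fraction-square-completion`; item stmt-AtomisticToContinuum-12057 — this file supports,
# does not close, the item)

Assembled from the landed files of the layer (`…FewBody5AllCouplingPT` = registered `stub_allCouplingPT`, the N-free
second-order perturbation theory; `…FewBody5Assembly`, `…FewBody5Window`, `…FewBody5Composition`, `…FewBody5WeakCoupling`)
and the discharged classical debt `stub_maxFormBound`:

* `fewBodyBounded5` / `fewBody_staticResponse5` — for every repulsive finite-range pair potential (hard cores included), every
  `N`, `L > 0` in the few-body regime `E₀(v,N,L)·L² ≤ 4π²/5` (NO factor `N`; seat c2 needed `N·E₀·L² ≤ 4π²/5`), every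
  `k ≠ 0`, `t` and finite-energy periodic `Ψ`: `E₀ − 14t²N/|p|² ≤ E_v(Ψ) + t⟨∑ⱼcos(p·xⱼ)⟩_Ψ`;
* `fewBody_staticResponse5_window` — at `L = (N/ρ)^{1/3}` the regime contains every `N` with `N⁵·ρa³ ≤ c(v)` (was `N⁸`), where
  the crux's inequality `Ineq` therefore holds with `C = 14`;
* `staticResponseBound_iff_largeNHalf5` / `staticResponseBound_iff_coreWeak5` — the crux `StaticResponseBound` is EQUIVALENT
  to its `N⁵ρa³ > c` content, and, for every `ε > 0`, to that content on the linear-response window `t² ≤ ε²ρa·max(ρa,|p|²)`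
  (registered `stub_coreWeak5` at `ε = 1`: the irreducible core — N-uniform Bogoliubov linear response in the thermodynamic limit).
-/

noncomputable section

namespace Summit.AtomisticToContinuum.BoseEinsteinCondensation.Cruxes.StaticResponseBound.FewBody5

open MeasureTheory Filter
open scoped ENNReal NNReal BigOperators
open Literature.MathematicalPhysics.QuantumManyBody.BoseGas
open Summit.AtomisticToContinuum.BoseEinsteinCondensation.Theses
open Summit.AtomisticToContinuum.BoseEinsteinCondensation.Theses.BECInsertionCorrector
open Summit.AtomisticToContinuum.BoseEinsteinCondensation.Theorems.StaticResponseBound.Negative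
open Summit.AtomisticToContinuum.BoseEinsteinCondensation.Cruxes.StaticResponseBound.UvThomsonForceWave
open Summit.AtomisticToContinuum.BoseEinsteinCondensation.Cruxes.StaticResponseBound.FewBody

/-- **The few-body static response bound, bounded potentials, quintic regime (unconditional).**  For every bounded repulsive
finite-range `w`, every `N`, every `L > 0` with `E₀(w,N,L)·L² ≤ 4π²/5`, every `k ≠ 0` (`p = 2πk/L`), every `t ∈ ℝ` and every
finite-energy periodic `Ψ`: `E₀(w,N,L) − 14 t² N/|p|² ≤ E_w(Ψ) + t⟨∑ⱼcos(p·xⱼ)⟩_Ψ`.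
[cite: ReedSimonIV1978, §XII.2; Davies1989, §4.2] -/
theorem fewBodyBounded5 :
    ∀ w : ℝ → ℝ≥0∞, IsRepulsiveFiniteRange w → (∃ M : ℝ≥0∞, M ≠ ⊤ ∧ ∀ r, w r ≤ M) →
      ∀ (N : ℕ) (L : ℝ), 0 < L →
        (periodicGroundStateEnergy w N L).toReal * L ^ 2 ≤ 4 * Real.pi ^ 2 / 5 →
        ∀ (k : Fin 3 → ℤ), k ≠ 0 → ∀ (t : ℝ) (Ψ : PeriodicTrialState N L), periodicEnergy w Ψ ≠ ⊤ →
          (periodicGroundStateEnergy w N L).toReal - 14 * t ^ 2 * N / psq L k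
            ≤ (periodicEnergy w Ψ).toReal + t * cosMean L k Ψ :=
  stub_fewBodyBounded5_of_allCouplingPT stub_allCouplingPT

/-- **The few-body static response bound, every admissible potential, quintic regime (unconditional; hard cores by
truncation and the discharged `MaxFormBound`).** [cite: ReedSimonIV1978, §XII.2 and Thm. XIII.64] -/
theorem fewBody_staticResponse5 :
    ∀ v : ℝ → ℝ≥0∞, IsRepulsiveFiniteRange v → ∀ (N : ℕ) (L : ℝ), 0 < L →
      (periodicGroundStateEnergy v N L).toReal * L ^ 2 ≤ 4 * Real.pi ^ 2 / 5 →
      ∀ (k : Fin 3 → ℤ), k ≠ 0 → ∀ (t : ℝ) (Ψ : PeriodicTrialState N L), periodicEnergy v Ψ ≠ ⊤ →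
        (periodicGroundStateEnergy v N L).toReal - 14 * t ^ 2 * N / psq L k
          ≤ (periodicEnergy v Ψ).toReal + t * cosMean L k Ψ :=
  fun _v hv _N _L hL hE _k hk t Ψ hΨ =>
    c5_fewBody_of_truncation fewBodyBounded5 (truncationLimit_of_maxFormBound stub_maxFormBound) hv hL hE hk t Ψ hΨ

/-- **The quintic window corollary.**  For every admissible `v` there are `ρ₀, c > 0` such that for `0 < ρ < ρ₀` and every
`N ≥ 1` with `N⁵·ρa³ ≤ c`, the crux's inequality `Ineq v 14 ρ N k t Ψ` holds for every `k ≠ 0`, `t` and finite-energy `Ψ`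
(window `stub_fewBodyWindow5` + `fewBody_staticResponse5`, ultraviolet branch `max(ρa,|p|²) = |p|²`). [folklore] -/
theorem fewBody_staticResponse5_window :
    ∀ v : ℝ → ℝ≥0∞, IsRepulsiveFiniteRange v →
      ∃ ρ₀ : ℝ, 0 < ρ₀ ∧ ∃ c : ℝ, 0 < c ∧
        ∀ ρ : ℝ, 0 < ρ → ρ < ρ₀ → ∀ N : ℕ, 1 ≤ N →
          (N : ℝ) ^ 5 * (ρ * (scatteringLength v).toReal ^ 3) ≤ c →
          ∀ k : Fin 3 → ℤ, k ≠ 0 → ∀ (t : ℝ) (Ψ : PeriodicTrialState N (sideLength ρ N)),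
            periodicEnergy v Ψ ≠ ⊤ → Ineq v 14 ρ N k t Ψ := by
  intro v hv
  obtain ⟨ρ₀, hρ₀, c, hc, hwin⟩ := stub_fewBodyWindow5 v hv
  refine ⟨ρ₀, hρ₀, c, hc, fun ρ hρ hρlt N hN hsmall k hk t Ψ hΨ => ?_⟩
  have hL : 0 < sideLength ρ N := sideLength_pos hρ hN
  obtain ⟨hE, hbr⟩ := hwin ρ hρ hρlt N hN hsmall
  have h := fewBody_staticResponse5 v hv N _ hL hE k hk t Ψ hΨ
  unfold Ineq
  rw [max_eq_right (hbr k hk)]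
  exact h

/-- **`StaticResponseBound ⟺ LargeNHalf5` (registered `staticResponseBound_iff_largeNHalf5`), unconditional:** the crux is
EXACTLY its `N⁵ρa³ > c` (every `c > 0`) content. [folklore] -/
theorem staticResponseBound_iff_largeNHalf5 :
    StaticResponseBound ↔
    (∀ v : ℝ → ℝ≥0∞, IsRepulsiveFiniteRange v → ∀ c : ℝ, 0 < c →
      ∃ ρ₀ : ℝ, 0 < ρ₀ ∧ ∃ C : ℝ, 0 < C ∧
        ∀ ρ : ℝ, 0 < ρ → ρ < ρ₀ → ∀ N : ℕ,
          c < (N : ℝ) ^ 5 * (ρ * (scatteringLength v).toReal ^ 3) →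
          ∀ k : Fin 3 → ℤ, k ≠ 0 → ∀ t : ℝ, ∀ Ψ : PeriodicTrialState N (sideLength ρ N),
            periodicEnergy v Ψ ≠ ⊤ → Ineq v C ρ N k t Ψ) :=
  stub_composition5 fewBodyBounded5 stub_fewBodyWindow5 (truncationLimit_of_maxFormBound stub_maxFormBound)

/-- **`StaticResponseBound ⟺ CoreWeak5 ε` for every `ε > 0` (registered `staticResponseBound_iff_coreWeak5`), unconditional:**
the crux is EXACTLY its large-`N` (`N⁵ρa³ > c`), linear-response-window (`t² ≤ ε²ρa·max(ρa,|p|²)`) content. [folklore] -/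
theorem staticResponseBound_iff_coreWeak5 :
    ∀ {ε : ℝ}, 0 < ε →
    (StaticResponseBound ↔
    (∀ v : ℝ → ℝ≥0∞, IsRepulsiveFiniteRange v → ∀ c : ℝ, 0 < c →
      ∃ ρ₀ : ℝ, 0 < ρ₀ ∧ ∃ C : ℝ, 0 < C ∧
        ∀ ρ : ℝ, 0 < ρ → ρ < ρ₀ → ∀ N : ℕ,
          c < (N : ℝ) ^ 5 * (ρ * (scatteringLength v).toReal ^ 3) →
          ∀ k : Fin 3 → ℤ, k ≠ 0 → ∀ t : ℝ,
            t ^ 2 ≤ ε ^ 2 * (ρ * (scatteringLength v).toReal) *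
              max (ρ * (scatteringLength v).toReal) (psq (sideLength ρ N) k) →
            ∀ Ψ : PeriodicTrialState N (sideLength ρ N), periodicEnergy v Ψ ≠ ⊤ → Ineq v C ρ N k t Ψ)) :=
  fun hε => by
    rw [staticResponseBound_iff_largeNHalf5]
    exact ⟨wc5_coreWeak5_of_largeNHalf5 _, stub_largeNHalf5_of_coreWeak5 hε⟩

end Summit.AtomisticToContinuum.BoseEinsteinCondensation.Cruxes.StaticResponseBound.FewBody5

end
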